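import Summits.RiemannHypothesis.RiemannHypothesis.Theorems.SignConeConeMagnificationStubCombZeroSide
import Literature.NumberTheory.LFunctions.WeilCombTwoPointSummable
import Literature.NumberTheory.LFunctions.WeilCombNodeForm

/-!
# Crux `SignCone.ConeMagnification` (stmt-RiemannHypothesis-16303), line `Sketch` r8: the comb inequality for a
# GENERAL real design (input of `stub_combType`)

For `c` with unit slack against every Weil test, a finitely supported real design `α` on `[1, L]` (`L ≥ 1`), a smooth
real bump `b` supported in `[-1, 1]` and `0 < ε ≤ 1`: for all `M ≥ max(M₀(ε), 4096L²)` the node sums of the `ζ`-mollified comb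
with window `√(log M)/M` satisfy the COMB INEQUALITY
`Σ_{ℓ,ℓ' ≤ L} α_ℓ α_ℓ' (E_c − E_Λ)(ℓ,ℓ') ≤ ((1+ε)/2) Σ_{ℓ,ℓ' ≤ L} α_ℓ α_ℓ' V_{ℓℓ'}(1)`
(`comb_inequality_design`): unit slack at the comb minus the landed comb zero-side lemma `stub_combZeroSide` (p140318) with
this `ε`, divided by the node forms `comb_prime_sum_re` / `comb_norm_sq` (p144291) — the factor `2` of the former against the
latter is where `½` comes from.  (The two-point case with `ε = 1` is `comb_inequality_of_unitSlack` in `…StubCombLocal`.)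
-/

noncomputable section

-- `Summit.RiemannHypothesis.RiemannHypothesis.…` repeats a namespace component by design (D-0017 layout).
set_option linter.dupNamespace false

open scoped BigOperators ComplexConjugate Topology ArithmeticFunction.vonMangoldt ContDiff
open Complex MeasureTheory Set Filter

namespace Summit.RiemannHypothesis.RiemannHypothesis.Theorems.SignConeConeMagnification

open Literature.NumberTheory.LFunctions

/-- **The comb inequality of a general real design from unit slack.**  See the module docstring. [folklore] -/
theorem comb_inequality_design (c : ℕ → ℝ)
    (hU : ∀ g : ℝ → ℂ, IsWeilTest g →
      -(∫ t, ‖g t‖ ^ 2) ≤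
        (weilPolarTerm (weilConv g (weilReflect g)) + weilArchTerm (weilConv g (weilReflect g)) -
          ∑' n : ℕ, ((c n : ℝ) : ℂ) / (Real.sqrt n : ℂ) *
            (weilConv g (weilReflect g) (Real.log n) + weilConv g (weilReflect g) (-Real.log n))).re)
    {α : ℕ → ℝ} {L : ℕ} (hα : ∀ m, L < m → α m = 0) (hL : 1 ≤ L)
    {b : ℝ → ℝ} (hb : ContDiff ℝ ∞ b) (hbc : HasCompactSupport b) (hbs : tsupport b ⊆ Icc (-1) 1)
    {ε : ℝ} (hε : 0 < ε) :
    ∃ M₁ : ℕ, ∀ M : ℕ, M₁ ≤ M →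
      (∑ ℓ ∈ Finset.Icc 1 L, ∑ ℓ' ∈ Finset.Icc 1 L, α ℓ * α ℓ' *
          ∑ n ∈ Finset.Icc 1 (3 * L * M), c n *
            ∑ k' ∈ Finset.Icc 1 M,
              (∑ k ∈ Finset.Icc 1 M, (∫ u, b u * b (u - (Real.log ((n : ℝ) * ℓ' * k' / ℓ) - Real.log k)
                  / (Real.sqrt (Real.log M) / M))) / Real.sqrt k) / Real.sqrt k' / Real.sqrt n) -
        (∑ ℓ ∈ Finset.Icc 1 L, ∑ ℓ' ∈ Finset.Icc 1 L, α ℓ * α ℓ' *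
          ∑ n ∈ Finset.Icc 1 (3 * L * M), (Λ n : ℝ) *
            ∑ k' ∈ Finset.Icc 1 M,
              (∑ k ∈ Finset.Icc 1 M, (∫ u, b u * b (u - (Real.log ((n : ℝ) * ℓ' * k' / ℓ) - Real.log k)
                  / (Real.sqrt (Real.log M) / M))) / Real.sqrt k) / Real.sqrt k' / Real.sqrt n) ≤
        (1 + ε) / 2 * ∑ ℓ ∈ Finset.Icc 1 L, ∑ ℓ' ∈ Finset.Icc 1 L, α ℓ * α ℓ' *
          ∑ k' ∈ Finset.Icc 1 M,
            (∑ k ∈ Finset.Icc 1 M, (∫ u, b u * b (u - (Real.log (((1 : ℕ) : ℝ) * ℓ' * k' / ℓ) - Real.log k)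
                / (Real.sqrt (Real.log M) / M))) / Real.sqrt k) / Real.sqrt k' / Real.sqrt ((1 : ℕ) : ℝ) := by
  -- the complexified bump
  set b₁ : ℝ → ℂ := fun t => ((b t : ℝ) : ℂ) with hb₁
  have hb₁W : IsWeilTest b₁ :=
    ⟨Complex.ofRealCLM.contDiff.comp hb, hbc.comp_left Complex.ofReal_zero⟩
  have hsupp₁ : tsupport b₁ ⊆ Icc (-1) 1 := by
    refine (closure_mono fun t ht => ?_).trans hbs
    simp only [Function.mem_support, hb₁, ne_eq, Complex.ofReal_eq_zero] at ht ⊢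
    exact ht
  -- the zero side with this `ε`
  obtain ⟨M₀, hM₀⟩ := stub_combZeroSide α L hα b₁ hb₁W hsupp₁ (1 / 2) (by norm_num) (by norm_num) ε hε
  refine ⟨max M₀ (4096 * L ^ 2), fun M hM => ?_⟩
  have hMM₀ : M₀ ≤ M := le_of_max_le_left hM
  have hM4096 : 4096 * L ^ 2 ≤ M := le_of_max_le_right hM
  obtain ⟨hlog1, hκ1, -, hh0, hhp, hhM1, hhM2, hh2, -, -, -⟩ := comb_params_of_large hL hM4096
  set κ : ℝ := Real.sqrt (Real.log M) with hκ
  have hκ0 : 0 < κ := by linarith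
  have hMpos : 0 < M := by
    have : 1 ≤ 4096 * L ^ 2 := by nlinarith
    omega
  have hMR : (0 : ℝ) < M := by exact_mod_cast hMpos
  have hκeq : Real.log M ^ (1 / 2 : ℝ) = κ := by rw [hκ, Real.sqrt_eq_rpow]
  -- the comb
  set g : ℝ → ℂ := fun u => ∑ m ∈ Finset.range (L * M + 1),
    ((∑ k ∈ (Nat.divisors m).filter (· ≤ M), α (m / k) / Real.sqrt k : ℝ) : ℂ) *
      b₁ ((u - Real.log m) * (M : ℝ) / κ) with hgdef
  have hgW : IsWeilTest g := by
    have hform : g = fun u => ∑ m ∈ Finset.range (L * M + 1),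
        ((∑ k ∈ (Nat.divisors m).filter (· ≤ M), α (m / k) / Real.sqrt k : ℝ) : ℂ) *
          b₁ ((u - Real.log m) * ((M : ℝ) / κ)) := by
      funext u
      simp only [hgdef, mul_div_assoc]
    rw [hform]
    exact isWeilTest_logComb hb₁W _ _ (div_pos hMR hκ0).ne'
  -- zero side at this `M`
  have hZ : |(weilPolarTerm (weilConv g (weilReflect g)) + weilArchTerm (weilConv g (weilReflect g)) -
      ∑' n : ℕ, ((ArithmeticFunction.vonMangoldt n : ℝ) : ℂ) / (Real.sqrt n : ℂ) *
        (weilConv g (weilReflect g) (Real.log n) + weilConv g (weilReflect g) (-Real.log n))).re| ≤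
      ε * ∫ u, ‖g u‖ ^ 2 := by
    have := hM₀ M hMM₀
    simpa only [hκeq] using this
  -- unit slack at this comb
  have hUS := hU g hgW
  -- node forms
  have hgform : g = fun u => ∑ m ∈ Finset.range (L * M + 1),
      ((∑ k ∈ (Nat.divisors m).filter (· ≤ M), α (m / k) / Real.sqrt k : ℝ) : ℂ) *
        ((b ((u - Real.log m) * (M : ℝ) / κ) : ℝ) : ℂ) := by
    funext u
    simp only [hgdef, hb₁]
  have hPc := comb_prime_sum_re hα hL hb.continuous hbc hbs hMpos hκ0 hh2 c (N := 3 * L * M) le_rfl g hgform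
  have hPΛ := comb_prime_sum_re hα hL hb.continuous hbc hbs hMpos hκ0 hh2
    (fun n => (Λ n : ℝ)) (N := 3 * L * M) le_rfl g hgform
  have hnorm := comb_norm_sq hα hb.continuous hbc hMpos hκ0 g hgform
  -- combine: `Re P_c − Re P_Λ ≤ (1 + ε) ‖g‖²`
  have hdiff : (∑' n : ℕ, ((c n : ℝ) : ℂ) / (Real.sqrt n : ℂ) *
        (weilConv g (weilReflect g) (Real.log n) + weilConv g (weilReflect g) (-Real.log n))).re -
      (∑' n : ℕ, ((Λ n : ℝ) : ℂ) / (Real.sqrt n : ℂ) *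
        (weilConv g (weilReflect g) (Real.log n) + weilConv g (weilReflect g) (-Real.log n))).re ≤
      (1 + ε) * ∫ u, ‖g u‖ ^ 2 := by
    have h1 := (abs_le.1 hZ).2
    rw [Complex.sub_re] at hUS h1
    linarith
  rw [hPc, hPΛ, hnorm] at hdiff
  -- divide by `2κ/M > 0`
  have hκM : 0 < κ / M := div_pos hκ0 hMR
  have h2 : 0 < 2 * (κ / M) := by positivity
  refine le_of_mul_le_mul_left ?_ h2
  have e : 2 * (κ / M) * ((1 + ε) / 2 * ∑ ℓ ∈ Finset.Icc 1 L, ∑ ℓ' ∈ Finset.Icc 1 L, α ℓ * α ℓ' *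
      ∑ k' ∈ Finset.Icc 1 M,
        (∑ k ∈ Finset.Icc 1 M, (∫ u, b u * b (u - (Real.log (((1 : ℕ) : ℝ) * ℓ' * k' / ℓ) - Real.log k)
            / (κ / M))) / Real.sqrt k) / Real.sqrt k' / Real.sqrt ((1 : ℕ) : ℝ)) =
      (1 + ε) * (κ / M * ∑ ℓ ∈ Finset.Icc 1 L, ∑ ℓ' ∈ Finset.Icc 1 L, α ℓ * α ℓ' *
      ∑ k' ∈ Finset.Icc 1 M,
        (∑ k ∈ Finset.Icc 1 M, (∫ u, b u * b (u - (Real.log (((1 : ℕ) : ℝ) * ℓ' * k' / ℓ) - Real.log k)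
            / (κ / M))) / Real.sqrt k) / Real.sqrt k' / Real.sqrt ((1 : ℕ) : ℝ)) := by ring
  rw [mul_sub, e]
  exact hdiff

/-- **Anchor `combInequalityDesign`** (registered sub-goal; `comb_inequality_design` with explicit quantifiers). [folklore] -/
theorem combInequalityDesign : ∀ c : ℕ → ℝ, (∀ g : ℝ → ℂ, IsWeilTest g →
      -(∫ t, ‖g t‖ ^ 2) ≤
        (weilPolarTerm (weilConv g (weilReflect g)) + weilArchTerm (weilConv g (weilReflect g)) -
          ∑' n : ℕ, ((c n : ℝ) : ℂ) / (Real.sqrt n : ℂ) *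
            (weilConv g (weilReflect g) (Real.log n) + weilConv g (weilReflect g) (-Real.log n))).re) →
    ∀ α : ℕ → ℝ, ∀ L : ℕ, (∀ m, L < m → α m = 0) → 1 ≤ L →
    ∀ b : ℝ → ℝ, ContDiff ℝ (⊤ : ℕ∞) b → HasCompactSupport b → tsupport b ⊆ Set.Icc (-1) 1 →
    ∀ ε : ℝ, 0 < ε →
    ∃ M₁ : ℕ, ∀ M : ℕ, M₁ ≤ M →
      (∑ ℓ ∈ Finset.Icc 1 L, ∑ ℓ' ∈ Finset.Icc 1 L, α ℓ * α ℓ' *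
          ∑ n ∈ Finset.Icc 1 (3 * L * M), c n *
            ∑ k' ∈ Finset.Icc 1 M,
              (∑ k ∈ Finset.Icc 1 M, (∫ u, b u * b (u - (Real.log ((n : ℝ) * ℓ' * k' / ℓ) - Real.log k)
                  / (Real.sqrt (Real.log M) / M))) / Real.sqrt k) / Real.sqrt k' / Real.sqrt n) -
        (∑ ℓ ∈ Finset.Icc 1 L, ∑ ℓ' ∈ Finset.Icc 1 L, α ℓ * α ℓ' *
          ∑ n ∈ Finset.Icc 1 (3 * L * M), (Λ n : ℝ) *
            ∑ k' ∈ Finset.Icc 1 M,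
              (∑ k ∈ Finset.Icc 1 M, (∫ u, b u * b (u - (Real.log ((n : ℝ) * ℓ' * k' / ℓ) - Real.log k)
                  / (Real.sqrt (Real.log M) / M))) / Real.sqrt k) / Real.sqrt k' / Real.sqrt n) ≤
        (1 + ε) / 2 * ∑ ℓ ∈ Finset.Icc 1 L, ∑ ℓ' ∈ Finset.Icc 1 L, α ℓ * α ℓ' *
          ∑ k' ∈ Finset.Icc 1 M,
            (∑ k ∈ Finset.Icc 1 M, (∫ u, b u * b (u - (Real.log (((1 : ℕ) : ℝ) * ℓ' * k' / ℓ) - Real.log k)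
                / (Real.sqrt (Real.log M) / M))) / Real.sqrt k) / Real.sqrt k' / Real.sqrt ((1 : ℕ) : ℝ) :=
  fun c hU _ _ hα hL _ hb hbc hbs _ hε => comb_inequality_design c hU hα hL hb hbc hbs hε

end Summit.RiemannHypothesis.RiemannHypothesis.Theorems.SignConeConeMagnification

end
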